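import Literature.Probability.LatticeModels.CollarLegModel

/-!
# Local lattice charts of a finite vertex set of `ℤ²`: the regularity hypotheses of the insertion dictionary

The insertion dictionary of the closed-collar `Δ = -1/2` height model with leg insertions
(`Literature.Probability.LatticeModels.CollarLegModel`, validation § of its module docstring:
`‖Zins V ι‖ = #{ω ⊆ E : rainbow}`) and already its Lemma V (unit height differences at every tracked
corner of the jump collar) are FALSE for general finite `V ⊂ ℤ²`, even lattice-connected and
hole-free ones: a unit square meeting `V` in exactly its two diagonal corners (PINCH), a fjord of
width one or two (FJORD) or a width-one neck joining two boxes (NECK) put arc vertices of a wired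
stretch next to collar faces of another stretch (exact evaluations recorded in the module
docstrings of `Summits/CriticalPhenomena/CardyFormulaZ2/Theorems/…StubRealisabilityPart34/Part46`).
They hold under three LOCAL CHART hypotheses, all satisfied eventually by the lattice
approximations `V_n = {v : δ_n v ∈ closure D}` of a Jordan domain `D` with rectilinear frontier
(`…StubRealisabilityPart47/48`: `s16_eventually_chart`, `s16_eventually_kingChart`, and
`stub_holeFree` for the two connectivities). This file only NAMES these hypotheses, so that
statements quantifying over general `V` (cluster locality of the rainbow functional, crux
`BoundaryDefectGaussianR` of `CardyFormulaZ2`) can carry them in a registered one-line text: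

* `IsLatticeConnected V` — any two vertices of `V` are joined by a lattice path in `V`;
* `HasKingConnectedComplement V` — any two points off `V` are joined by a king path off `V`
  (no holes, no king-diagonal far components);
* `HasBoundaryCharts V` — CHART(3): at every boundary vertex `u ∈ V` (`u + dir k ∉ V`), on the
  `7 × 7` box about `u`, `V` is a lattice half-plane, a convex quadrant or a reflex co-quadrant;
* `HasKingCharts V` — KINGCHART(6): at every point `z ∉ V` king-adjacent to `V`, on the `13 × 13`
  box about `z`, `V` is a closed quadrant / half-plane (`σ` or `τ` may vanish) or the complement of
  an open one;
* `ChartRegular V := IsLatticeConnected V ∧ HasBoundaryCharts V ∧ HasKingCharts V`.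

The texts are character-for-character the hypotheses of the landed dictionary theorems
(`s13_unitDifferences`, `s15_cellRegion_rim`, `s17_dictionary`), so that `h.1 / h.2.1 / h.2.2`
feed them directly. Pure definitions; nothing is asserted. [folklore]
-/

namespace Literature.Probability.LatticeModels.CollarLegModel

/-- **Lattice-connectedness** of a finite `V ⊂ ℤ²`: any two vertices of `V` are joined by a path of
unit lattice steps inside `V`. [folklore] -/
def IsLatticeConnected (V : Finset (ℤ × ℤ)) : Prop :=
  ∀ u ∈ V, ∀ w ∈ V, Relation.ReflTransGen (fun b c : ℤ × ℤ ↦ b ∈ V ∧ c ∈ V ∧ (b.1 - c.1) ^ 2 + (b.2 - c.2) ^ 2 = 1) u w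

/-- **King-connected complement** (hole-freeness in the strong form the collar model needs): any two
points off `V` are joined by a path of king steps (sup-norm `≤ 1`) off `V`. [folklore] -/
def HasKingConnectedComplement (V : Finset (ℤ × ℤ)) : Prop :=
  ∀ u ∉ V, ∀ w ∉ V, Relation.ReflTransGen (fun b c : ℤ × ℤ ↦ b ∉ V ∧ c ∉ V ∧ max |b.1 - c.1| |b.2 - c.2| ≤ 1) u w

/-- **Boundary charts of radius `3`** (hypothesis CHART of the insertion dictionary): at every boundary
vertex `u ∈ V` with `u + dir k ∉ V`, on the box `|v.1 - u.1| ≤ 3, |v.2 - u.2| ≤ 3` the set `V` is a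
lattice half-plane `c₂ ≤ ⟨v, dir (K+1)⟩`, a convex quadrant `c₁ ≤ ⟨v, dir K⟩ ∧ c₂ ≤ ⟨v, dir (K+1)⟩`,
or a reflex co-quadrant `c₂ ≤ ⟨v, dir (K+1)⟩ ∨ ⟨v, dir K⟩ ≤ c₁`. [folklore] -/
def HasBoundaryCharts (V : Finset (ℤ × ℤ)) : Prop :=
  ∀ u ∈ V, ∀ k : Fin 4, u + dir k ∉ V → ∃ (K : Fin 4) (c₁ c₂ : ℤ), (∀ v : ℤ × ℤ, |v.1 - u.1| ≤ 3 → |v.2 - u.2| ≤ 3 → (v ∈ V ↔ c₂ ≤ v.1 * (dir (K + 1)).1 + v.2 * (dir (K + 1)).2)) ∨ (∀ v : ℤ × ℤ, |v.1 - u.1| ≤ 3 → |v.2 - u.2| ≤ 3 → (v ∈ V ↔ c₁ ≤ v.1 * (dir K).1 + v.2 * (dir K).2 ∧ c₂ ≤ v.1 * (dir (K + 1)).1 + v.2 * (dir (K + 1)).2)) ∨ (∀ v : ℤ × ℤ, |v.1 - u.1| ≤ 3 → |v.2 - u.2| ≤ 3 → (v ∈ V ↔ c₂ ≤ v.1 *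 (dir (K + 1)).1 + v.2 * (dir (K + 1)).2 ∨ v.1 * (dir K).1 + v.2 * (dir K).2 ≤ c₁))

/-- **King charts of radius `6`** (hypothesis KINGCHART of the rim theorem `s15_cellRegion_rim`): at every
point `z ∉ V` king-adjacent to `V`, on the sup-norm box of radius `6` about `z` the set `V` is a closed
quadrant or half-plane `0 ≤ σ (v.1 - a) ∧ 0 ≤ τ (v.2 - c)` (`|σ|, |τ| ≤ 1`) or the complement of an
open one. [folklore] -/
def HasKingCharts (V : Finset (ℤ × ℤ)) : Prop :=
  ∀ z : ℤ × ℤ, z ∉ V → (∃ v ∈ V, max |v.1 - z.1| |v.2 - z.2| ≤ 1) → ∃ σ τ a c : ℤ, |σ| ≤ 1 ∧ |τ| ≤ 1 ∧ ((∀ v : ℤ × ℤ, max |v.1 - z.1| |v.2 - z.2| ≤ 6 → (v ∈ V ↔ 0 ≤ σ * (v.1 - a) ∧ 0 ≤ τ * (v.2 - c))) ∨ (∀ v : ℤ × ℤ, max |v.1 - z.1| |v.2 - z.2| ≤ 6 → (v ∈ V ↔ 0 < σ * (v.1 - a) ∨ 0 < τ * (v.2 - c))))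

/-- **Chart-regularity** of a finite `V ⊂ ℤ²`: lattice-connected with boundary charts of radius `3` and
king charts of radius `6` — the local regularity (besides the king-connected complement) under which the
insertion dictionary `‖Zins V ι‖ = #{rainbow}` holds; eventually true for the lattice approximations of a
Jordan domain with rectilinear frontier. [folklore] -/
def ChartRegular (V : Finset (ℤ × ℤ)) : Prop :=
  IsLatticeConnected V ∧ HasBoundaryCharts V ∧ HasKingCharts V

/-- Unfolding `ChartRegular`. [folklore] -/
theorem chartRegular_iff (V : Finset (ℤ × ℤ)) :
    ChartRegular V ↔ IsLatticeConnected V ∧ HasBoundaryCharts V ∧ HasKingCharts V := Iff.rfl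

/-- Assembling `ChartRegular` from its three clauses. [folklore] -/
theorem ChartRegular.mk' {V : Finset (ℤ × ℤ)} (h₁ : IsLatticeConnected V) (h₂ : HasBoundaryCharts V)
    (h₃ : HasKingCharts V) : ChartRegular V := ⟨h₁, h₂, h₃⟩

end Literature.Probability.LatticeModels.CollarLegModel
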